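import Summits.QuantumFields.BalabanUV.Beta.D1BFx.PeriodicArrayWrapLimit

/-!
# `BalabanUV.Beta.D1BFx.PeriodicArrayWrapUniform` — road «BF-x» for binder row D1, slot (K), chain step (I) «(A1)-PACKED», brick «WRAP-LIMIT», part 2
# «WRAP-UNIFORM» (`HOME/b2b-balaban-beta-d1-p2/A1-PACKED-SPEC.md` v0.3.1 §8, FINDING F-g16-1 «WRAP»): **UNDER BOND-SEPARATION DECAY OF THE PAIR FAMILY
# THE `ℤ^D` KERNEL WITH ONE WEIGHT PERIODISED IS BI-LOCALISED UNIFORMLY IN THE PERIOD** — the `s`-free `BiLoc` data that the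
# `TorusArrayLimitUniform.tendsto_…_of_uniform` sockets consume together with `PeriodicArrayWrapLimit.tendsto_wsum_images`.

HONEST DEPENDENCY (cell records, verbatim): «continuum YM on T⁴ ⇐ BetaPertH ∧ nine spine estimates (0/9 proved); BetaPertH ⇐ (D1) ∧ (D4) ∧
CAP+tail; G-an2-4 gates asym, D1 and NE2/3/4.»  HONEST FRAMING (cell contract, verbatim): «discharging `BetaPertH` makes Bałaban's UV stability
UNCONDITIONAL — a real constructive-QFT result; it is NOT the continuum limit and NOT the Clay problem.»  THIS MODULE DISCHARGES NOTHING of (K),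
of D1 or of the wall: [folklore] absolutely convergent `ℤ^D` bookkeeping (termwise exponential majorants, `tsum_of_norm_bounded`,
`OneStepResolventKernel.biLoc_wsum`) over the typed objects `OneStepResolventKernel.wsum`, `VolumeImages.imageShift`, `ExpKernelCalculus.BiLoc`.
No definition, no `def … : Prop`, nothing cited, 0 sorry.  0 root-level binders of row D1 discharged (hW ∕ hR-sockets ∕ hSX-socket ∕ D1Tel ∕ D1Rep = 0);
(K) NOT closed; NOT D1, NOT `BetaPertH`, NOT continuum, NOT Clay.

ABSOLUTE RULE (cell charter, verbatim): «No internally-minted statement may enter as a cited fact. Every hypothesis is either kernel-proved in this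
package or a verbatim quotation of a PUBLISHED theorem with page reference. The manuscript(s) under audit are NOT citable for their own disputed
steps — they are the thing under adjudication; programme-internal (2001/route/tribunal) claims are never citable.»

WHY (owner d1-p2, FINDING F-g16-1 «WRAP»: «𝒲M^{(p)} … honest `ℤ⁴` kernels, `BiLoc` … with p-UNIFORM constants, `→ 𝒲M` entrywise»).  The entrywise limit is
`PeriodicArrayWrapLimit.tendsto_wsum_images`; the `p`-UNIFORM `BiLoc` is THIS file.  It needs MORE than the (B4d) hypothesis `BiLoc (K₂ u u′) u u′ Cₖ δ`:
under that shape the periodised kernel `𝒲^{(s)} := wsum w (u ↦ Σ'_{u″} (Σ'_m w′ (u″ + s·m)) · K₂ u u″)` is only LEFT-localised (LOCATED REMARK, documentation: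
`D = 1`, `K₂ u u″ x y = [x = u]·[y = u″]`, `w = [· = p]`, `w′ = [· = p′]` give `𝒲^{(s)} x y = [x = p]·[y ≡ p′ mod s]`, periodic in `y` — not `BiLoc` at any pair,
for any one `s`).  The road's bi-stencil families carry BOND-SEPARATION decay — the body of `BalabanCompositeJets.LocStencil₂`:
`BiLoc (K₂ u u′) u u (Cₖ·e^{−δ|u′−u|₁}) δ` — and under it `BiLoc 𝒲^{(s)} p p (C·C′·Cₖ·Zl D (δ∕2)³) (δ∕2)` for EVERY `s ≥ 1` (and the same shape for the limit
kernel `𝒲`).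

CONTENT (all [folklore]; generic dimension `D`, fibre `F`).
* `biLoc_pair_of_sep` (the `LocStencil₂` body implies the (B4d) shape `BiLoc (K₂ u u′) u u′ Cₖ δ`, so `PeriodicArrayWrapLimit` §3 applies verbatim),
  `abs_tsum_images_mul_exp_le` (`|Σ'_m w′ (u″ + s·m)|·e^{−δ|u″−u|₁} ≤ C′·Zl D (δ∕2)·e^{−(δ∕2)|u″−u|₁}`, uniformly in `s` and `p′`),
  `biLoc_row_images` (`BiLoc (u″-row of 𝒲^{(s)} at u) u u (C′·Cₖ·Zl D (δ∕2)²) δ`), **`biLoc_wsum_images`** («WRAP-UNIFORM»), `biLoc_row`, `biLoc_wsum_plain`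
  (the limit kernel: `BiLoc 𝒲 p p (C·C′·Cₖ·Zl D δ·Zl D (δ∕2)) (δ∕2)`).
Provenance: G-an2-4 swarm leaf seat `b2b-balaban-gan24-formalise-leaf-05` (gen 50), cross-lane brick «WRAP-LIMIT» part 2 for road «BF-x», 2026-08-22.
-/

noncomputable section

namespace Summit.QuantumFields.BalabanUV.Beta.D1BFx.PeriodicArrayWrapUniform

open Filter Topology
open scoped BigOperators
open Literature.MathematicalPhysics.QuantumFieldTheory.Balaban1983to89
open Literature.MathematicalPhysics.QuantumFieldTheory.Balaban1983to89.Beta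
open B12Sec2to5 (l1 l1_nonneg summable_exp_neg_l1)
open ExpKernelCalculus (MKer BiLoc Zl Zl_pos Zl_nonneg summable_exp_shift summable_exp_shift' tsum_exp_shift tsum_exp_shift'
  l1_sub_triangle l1_sub_symm)
open OneStepResolventKernel (wsum biLoc_wsum)
open Summit.QuantumFields.BalabanUV.Beta.D1BFx.PeriodicArrays (imageShift_eq_add_smul tsum_exp_imageShift_le)
open Summit.QuantumFields.BalabanUV.Beta.D1BFx.PeriodicArrayWrapLimit (const_nonneg_of_weight abs_weight_le_const)

variable {D : ℕ} {F : Type*}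

/-! ## Bond-separation decay: the periodised kernel is bi-localised uniformly in the period («WRAP-UNIFORM») -/

section Uniform

variable {w w' : ExpKernelCalculus.Site D → ℝ} {K₂ : ExpKernelCalculus.Site D → ExpKernelCalculus.Site D → MKer D F} {C C' Ck δ : ℝ}
  {p p' : ExpKernelCalculus.Site D}

/-- [folklore] THE `LocStencil₂` BODY IMPLIES THE (B4d) SHAPE: a pair family bi-localised at its FIRST bond with a constant decaying in the bond separation
(`BiLoc (K₂ u u′) u u (Cₖ·e^{−δ|u′−u|₁}) δ`, the body of `BalabanCompositeJets.LocStencil₂`) is bi-localised at the pair `(u, u′)` with constant `Cₖ`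
(`|u′−u|₁ + |y−u|₁ ≥ |y−u′|₁`) — so §3 applies to such families verbatim. -/
theorem biLoc_pair_of_sep (hK : ∀ u u', BiLoc (K₂ u u') u u (Ck * Real.exp (-δ * l1 (u' - u))) δ) (hδ : 0 ≤ δ)
    (u u' : ExpKernelCalculus.Site D) : BiLoc (K₂ u u') u u' Ck δ := by
  intro x y a b
  have hCk : 0 ≤ Ck := by
    have h := (hK u u).nonneg a
    rwa [sub_self, show l1 (0 : ExpKernelCalculus.Site D) = 0 by simp [l1], mul_zero, Real.exp_zero, mul_one] at h
  refine (hK u u' x y a b).trans ?_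
  rw [mul_assoc, ← Real.exp_add]
  refine mul_le_mul_of_nonneg_left (Real.exp_le_exp.2 ?_) hCk
  have htri : l1 (y - u') ≤ l1 (y - u) + l1 (u' - u) := by
    have h := l1_sub_triangle y u u'
    rw [l1_sub_symm u u'] at h
    exact h
  nlinarith [l1_nonneg (x - u)]

/-- [folklore] THE PERIODISED WEIGHT AGAINST THE BOND-SEPARATION FACTOR: for `w′` decaying from `p′` (rate `δ > 0`, `s ≥ 1`),
`|Σ'_m w′ (u″ + s·m)|·e^{−δ|u″−u|₁} ≤ C′·Zl D (δ∕2)·e^{−(δ∕2)|u″−u|₁}` — uniformly in `s` and in the centre `p′` (each image: `|u″+sm−p′|₁ + |u″−u|₁ ≥ |u+sm−p′|₁`;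
half the rate keeps the separation factor, the other half sums the images of `u` by `PeriodicArrays.tsum_exp_imageShift_le`). -/
theorem abs_tsum_images_mul_exp_le (hw' : ∀ u, |w' u| ≤ C' * Real.exp (-δ * l1 (u - p'))) (hδ : 0 < δ) (s : ℕ) [NeZero s]
    (u u'' : ExpKernelCalculus.Site D) :
    |∑' m : ExpKernelCalculus.Site D, w' (imageShift s u'' m)| * Real.exp (-δ * l1 (u'' - u))
      ≤ C' * Zl D (δ / 2) * Real.exp (-(δ / 2) * l1 (u'' - u)) := by
  have hC' : 0 ≤ C' := const_nonneg_of_weight hw'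
  have hδ2 : 0 < δ / 2 := half_pos hδ
  -- (i) `|Σ' w′(images)| ≤ C′·Σ' e^{−δ|u″+sm−p′|₁}`
  have hsum := (tsum_exp_imageShift_le hδ s u'' p').1
  have hmaj := hsum.mul_left C'
  have h1 := tsum_of_norm_bounded hmaj.hasSum (fun m => by rw [Real.norm_eq_abs]; exact hw' (imageShift s u'' m))
  rw [Real.norm_eq_abs, tsum_mul_left] at h1
  -- (ii) termwise: `e^{−δ A_m}·e^{−δ B} ≤ e^{−(δ∕2) L_m}·e^{−(δ∕2) B}`
  have hsum2 := (tsum_exp_imageShift_le hδ2 s u p').1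
  have hterm : ∀ m : ExpKernelCalculus.Site D,
      Real.exp (-δ * l1 (imageShift s u'' m - p')) * Real.exp (-δ * l1 (u'' - u))
        ≤ Real.exp (-(δ / 2) * l1 (imageShift s u m - p')) * Real.exp (-(δ / 2) * l1 (u'' - u)) := by
    intro m
    rw [← Real.exp_add, ← Real.exp_add, Real.exp_le_exp]
    have htri : l1 (imageShift s u m - p') ≤ l1 (imageShift s u'' m - p') + l1 (u'' - u) := by
      have e : imageShift s u m - p' = (imageShift s u'' m - p') - (u'' - u) := by
        rw [imageShift_eq_add_smul, imageShift_eq_add_smul]; abel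
      rw [e]
      exact PeriodicArrays.l1_sub_le _ _
    nlinarith [l1_nonneg (u'' - u), l1_nonneg (imageShift s u'' m - p')]
  have hle : (∑' m : ExpKernelCalculus.Site D, Real.exp (-δ * l1 (imageShift s u'' m - p'))) * Real.exp (-δ * l1 (u'' - u))
      ≤ Zl D (δ / 2) * Real.exp (-(δ / 2) * l1 (u'' - u)) := by
    rw [← tsum_mul_right]
    calc ∑' m : ExpKernelCalculus.Site D, Real.exp (-δ * l1 (imageShift s u'' m - p')) * Real.exp (-δ * l1 (u'' - u))
        ≤ ∑' m : ExpKernelCalculus.Site D, Real.exp (-(δ / 2) * l1 (imageShift s u m - p')) * Real.exp (-(δ / 2) * l1 (u'' - u)) :=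
          (hsum.mul_right _).tsum_le_tsum hterm (hsum2.mul_right _)
      _ = (∑' m : ExpKernelCalculus.Site D, Real.exp (-(δ / 2) * l1 (imageShift s u m - p'))) * Real.exp (-(δ / 2) * l1 (u'' - u)) :=
          tsum_mul_right
      _ ≤ Zl D (δ / 2) * Real.exp (-(δ / 2) * l1 (u'' - u)) :=
          mul_le_mul_of_nonneg_right (tsum_exp_imageShift_le hδ2 s u p').2 (Real.exp_pos _).le
  calc |∑' m : ExpKernelCalculus.Site D, w' (imageShift s u'' m)| * Real.exp (-δ * l1 (u'' - u))
      ≤ (C' * ∑' m : ExpKernelCalculus.Site D, Real.exp (-δ * l1 (imageShift s u'' m - p'))) * Real.exp (-δ * l1 (u'' - u)) :=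
        mul_le_mul_of_nonneg_right h1 (Real.exp_pos _).le
    _ = C' * ((∑' m : ExpKernelCalculus.Site D, Real.exp (-δ * l1 (imageShift s u'' m - p'))) * Real.exp (-δ * l1 (u'' - u))) := by ring
    _ ≤ C' * (Zl D (δ / 2) * Real.exp (-(δ / 2) * l1 (u'' - u))) := mul_le_mul_of_nonneg_left hle hC'
    _ = _ := by ring

/-- [folklore] **THE `u″`-ROW OF THE PERIODISED KERNEL IS BI-LOCALISED AT ITS BOND, UNIFORMLY IN `s`**: under bond-separation decay of the pair family,
`BiLoc (x y a b ↦ Σ'_{u″} (Σ'_m w′ (u″ + s·m)) · K₂ u u″ x y a b) u u (C′·Cₖ·Zl D (δ∕2)²) δ` for every `s ≥ 1`. -/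
theorem biLoc_row_images (hw' : ∀ u, |w' u| ≤ C' * Real.exp (-δ * l1 (u - p')))
    (hK : ∀ u u', BiLoc (K₂ u u') u u (Ck * Real.exp (-δ * l1 (u' - u))) δ) (hδ : 0 < δ) (s : ℕ) [NeZero s] (u : ExpKernelCalculus.Site D) :
    BiLoc (fun x y a b => ∑' u'', (∑' m : ExpKernelCalculus.Site D, w' (imageShift s u'' m)) * K₂ u u'' x y a b) u u
      (C' * Ck * Zl D (δ / 2) * Zl D (δ / 2)) δ := by
  intro x y a b
  have hC' : 0 ≤ C' := const_nonneg_of_weight hw'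
  have hCk : 0 ≤ Ck := (biLoc_pair_of_sep hK hδ.le u u).nonneg a
  have hδ2 : 0 < δ / 2 := half_pos hδ
  set E : ℝ := Real.exp (-δ * (l1 (x - u) + l1 (y - u))) with hE
  have hmaj := (summable_exp_shift' hδ2 u).mul_left (Ck * E * (C' * Zl D (δ / 2)))
  have hb : ∀ u'', ‖(∑' m : ExpKernelCalculus.Site D, w' (imageShift s u'' m)) * K₂ u u'' x y a b‖
      ≤ Ck * E * (C' * Zl D (δ / 2)) * Real.exp (-(δ / 2) * l1 (u'' - u)) := by
    intro u''
    rw [Real.norm_eq_abs, abs_mul]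
    have h2 := hK u u'' x y a b
    have hEpos : 0 ≤ Ck * E := by positivity
    calc |∑' m : ExpKernelCalculus.Site D, w' (imageShift s u'' m)| * |K₂ u u'' x y a b|
        ≤ |∑' m : ExpKernelCalculus.Site D, w' (imageShift s u'' m)| * (Ck * Real.exp (-δ * l1 (u'' - u)) * E) :=
          mul_le_mul_of_nonneg_left h2 (abs_nonneg _)
      _ = Ck * E * (|∑' m : ExpKernelCalculus.Site D, w' (imageShift s u'' m)| * Real.exp (-δ * l1 (u'' - u))) := by ring
      _ ≤ Ck * E * (C' * Zl D (δ / 2) * Real.exp (-(δ / 2) * l1 (u'' - u))) :=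
          mul_le_mul_of_nonneg_left (abs_tsum_images_mul_exp_le hw' hδ s u u'') hEpos
      _ = _ := by ring
  have h := tsum_of_norm_bounded hmaj.hasSum hb
  rw [Real.norm_eq_abs] at h
  refine h.trans (le_of_eq ?_)
  rw [tsum_mul_left, tsum_exp_shift', hE]; ring

/-- [folklore] **«WRAP-UNIFORM» — THE PERIODISED KERNEL IS BI-LOCALISED UNIFORMLY IN THE PERIOD**: for weights `w`, `w′` decaying from `p`, `p′` (rate `δ > 0`)
and a pair family with bond-separation decay `BiLoc (K₂ u u′) u u (Cₖ·e^{−δ|u′−u|₁}) δ` (the `LocStencil₂` body), for EVERY `s ≥ 1`: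
`BiLoc (wsum w (u ↦ Σ'_{u″} (Σ'_m w′ (u″ + s·m)) · K₂ u u″)) p p (C·C′·Cₖ·Zl D (δ∕2)³) (δ∕2)` — `s`-free data, the hypothesis shape `∀ k, BiLoc (K k) p q C δ`
of the `TorusArrayLimitUniform.tendsto_…_of_uniform` sockets (with §3's entrywise limit).  (`OneStepResolventKernel.biLoc_wsum` on `biLoc_row_images`.) -/
theorem biLoc_wsum_images (hw : ∀ u, |w u| ≤ C * Real.exp (-δ * l1 (u - p))) (hw' : ∀ u, |w' u| ≤ C' * Real.exp (-δ * l1 (u - p')))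
    (hK : ∀ u u', BiLoc (K₂ u u') u u (Ck * Real.exp (-δ * l1 (u' - u))) δ) (hδ : 0 < δ) (s : ℕ) [NeZero s] :
    BiLoc (wsum w (fun u => fun x y a b => ∑' u'', (∑' m : ExpKernelCalculus.Site D, w' (imageShift s u'' m)) * K₂ u u'' x y a b)) p p
      (C * (C' * Ck * Zl D (δ / 2) * Zl D (δ / 2)) * Zl D (δ / 2)) (δ / 2) :=
  biLoc_wsum hw (fun u => biLoc_row_images hw' hK hδ s u) hδ (const_nonneg_of_weight hw)

/-- [folklore] THE `u″`-ROW OF THE LIMIT KERNEL: `BiLoc (x y a b ↦ Σ'_{u″} w′ u″ · K₂ u u″ x y a b) u u (C′·Cₖ·Zl D δ) δ` under bond-separation decay. -/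
theorem biLoc_row (hw' : ∀ u, |w' u| ≤ C' * Real.exp (-δ * l1 (u - p')))
    (hK : ∀ u u', BiLoc (K₂ u u') u u (Ck * Real.exp (-δ * l1 (u' - u))) δ) (hδ : 0 < δ) (u : ExpKernelCalculus.Site D) :
    BiLoc (fun x y a b => ∑' u'', w' u'' * K₂ u u'' x y a b) u u (C' * Ck * Zl D δ) δ := by
  intro x y a b
  have hC' : 0 ≤ C' := const_nonneg_of_weight hw'
  have hCk : 0 ≤ Ck := (biLoc_pair_of_sep hK hδ.le u u).nonneg a
  set E : ℝ := Real.exp (-δ * (l1 (x - u) + l1 (y - u))) with hE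
  have hmaj := (summable_exp_shift' hδ u).mul_left (C' * Ck * E)
  have hb : ∀ u'', ‖w' u'' * K₂ u u'' x y a b‖ ≤ C' * Ck * E * Real.exp (-δ * l1 (u'' - u)) := by
    intro u''
    rw [Real.norm_eq_abs, abs_mul]
    calc |w' u''| * |K₂ u u'' x y a b| ≤ C' * (Ck * Real.exp (-δ * l1 (u'' - u)) * E) :=
          mul_le_mul (abs_weight_le_const hw' hδ.le u'') (hK u u'' x y a b) (abs_nonneg _) hC'
      _ = _ := by ring
  have h := tsum_of_norm_bounded hmaj.hasSum hb
  rw [Real.norm_eq_abs] at h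
  refine h.trans (le_of_eq ?_)
  rw [tsum_mul_left, tsum_exp_shift', hE]; ring

/-- [folklore] THE LIMIT KERNEL IS BI-LOCALISED: `BiLoc (wsum w (u ↦ Σ'_{u″} w′ u″ · K₂ u u″)) p p (C·C′·Cₖ·Zl D δ·Zl D (δ∕2)) (δ∕2)` under bond-separation decay
(the road's `ℤ^D` second table; the same shape as the uniform one). -/
theorem biLoc_wsum_plain (hw : ∀ u, |w u| ≤ C * Real.exp (-δ * l1 (u - p))) (hw' : ∀ u, |w' u| ≤ C' * Real.exp (-δ * l1 (u - p')))
    (hK : ∀ u u', BiLoc (K₂ u u') u u (Ck * Real.exp (-δ * l1 (u' - u))) δ) (hδ : 0 < δ) :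
    BiLoc (wsum w (fun u => fun x y a b => ∑' u'', w' u'' * K₂ u u'' x y a b)) p p (C * (C' * Ck * Zl D δ) * Zl D (δ / 2)) (δ / 2) :=
  biLoc_wsum hw (fun u => biLoc_row hw' hK hδ u) hδ (const_nonneg_of_weight hw)

end Uniform

end Summit.QuantumFields.BalabanUV.Beta.D1BFx.PeriodicArrayWrapUniform

end
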